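import Mathlib
import Summits.Ventures.DiscreteObjects.Mahler.FourTermCyclotomicFactors
import Summits.Ventures.DiscreteObjects.Mahler.MahlerMeasureCompXPow
import Summits.Ventures.DiscreteObjects.Mahler.SubLehmerDegreeTwentyFour

/-!
# Sparse reciprocal polynomials VI: the family `p + q = |b| (q - p)` and ALL quadrinomials with `|b| ≥ 3`
(venture `DiscreteObjects`, target L)

Cell `pub-namedobj`, seat `pub-namedobj-mahler-g24`. Framing: lottery ticket; floor = certified
bounds/negative ranges.

`P = x^{p+q} + b x^p + s b x^q + s`, `|b| ≥ 3`, `0 < p < q`, `s = ±1`, `k = q - p`, `n = p + q`.  In the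
family `n = |b| k` cyclotomic factors may be repeated (`(x^k + 1)³` for `b = 3`, `s = 1`); we bound
their multiplicity by a fewnomial argument:

* `not_cyclotomic_pow_four_dvd_quadrinomial` — no `Φ_r⁴` divides a quadrinomial: with
  `L_c F = x F' - c F`, `L_p L_q L_n P = -s n p q` is a nonzero constant, while `Φ^{m+1} ∣ F` gives
  `Φ^m ∣ L_c F`;
* `exists_round_quadrinomial` / `exists_cyclotomicFree_factor_quadrinomial_three` — three peeling
  rounds: `P = D · Q`, `Q` cyclotomic-free, `D ∣ (x^k + s)³` (so `deg D ≤ 3k`, `M(D) = 1`);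
* `not_subLehmer_quadrinomial_special` — for `n = |b| k`: `|b| = 3` gives `P = R(x^k)` with `deg R = 3`
  (kernel ladder); `|b| ≥ 4` gives `(|b|/2)^{(|b|-3)k} ≤ M^{|b| k}`, hence `M⁴ ≥ 2`;
* `not_subLehmer_quadrinomial_of_three_le_abs'` — together with `FourTermCyclotomicFactors`:
  **no quadrinomial `x^{p+q} + b x^p + s b x^q + s` with `|b| ≥ 3` is sub-Lehmer.**

In print: [Dobrowolski2006] E. Dobrowolski, Acta Arith. 123 (2006), Prop. 2 (`M(f) ≥ θ₀`, sharp), whose proof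
bounds the multiplicity of the roots of unity by `3` exactly as here; kernel formalisation (REPLICATION), with
the weaker kernel-certified conclusion "not sub-Lehmer" for the residual family.
-/

namespace Summit.Ventures.DiscreteObjects.Mahler

open Polynomial

section Quadrinomial

variable {p q : ℕ} {b s : ℤ}

/-- `x · F'` for a four-term shape `F = a xⁿ + c x^p + d x^q + e` (`n, p, q ≥ 1`). -/
theorem X_mul_derivative_four {n : ℕ} (hn : 0 < n) (hp : 0 < p) (hq : 0 < q) (a c d e : ℤ) :
    X * derivative (C a * X ^ n + C c * X ^ p + C d * X ^ q + C e : ℤ[X]) =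
      C (a * n) * X ^ n + C (c * p) * X ^ p + C (d * q) * X ^ q := by
  simp only [derivative_add, derivative_C_mul_X_pow, derivative_C, add_zero]
  have e1 : ∀ {m : ℕ}, 0 < m → (X : ℤ[X]) * X ^ (m - 1) = X ^ m := fun hm => mul_pow_sub_one (by omega) X
  rw [mul_add, mul_add, ← mul_assoc, mul_comm X (C _), mul_assoc, e1 hn, ← mul_assoc, mul_comm X (C _),
    mul_assoc, e1 hp, ← mul_assoc, mul_comm X (C _), mul_assoc, e1 hq]

/-- If `Φ^{m+1} ∣ F` then `Φ^m ∣ x F' - c F`. -/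
theorem pow_dvd_X_mul_derivative_sub {Φ F : ℤ[X]} {m : ℕ} (h : Φ ^ (m + 1) ∣ F) (c : ℤ) :
    Φ ^ m ∣ X * derivative F - C c * F := by
  refine dvd_sub (dvd_mul_of_dvd_right ?_ _) (dvd_mul_of_dvd_right (dvd_trans (pow_dvd_pow Φ (by omega)) h) _)
  have := pow_sub_one_dvd_derivative_of_pow_dvd h
  simpa using this

/-- **No fourth power of a cyclotomic polynomial divides a quadrinomial** `x^{p+q} + b x^p + s b x^q + s`
(`0 < p < q`, `s ≠ 0`): with `L_c F = x F' - c F` one has `L_p (L_q (L_n P)) = -s n p q ≠ 0`, while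
`Φ⁴ ∣ P` would give `Φ ∣ L_p (L_q (L_n P))`. -/
theorem not_cyclotomic_pow_four_dvd_quadrinomial (hp : 0 < p) (hpq : p < q) (hs : s = 1 ∨ s = -1)
    (b : ℤ) {r : ℕ} (hr : 0 < r) :
    ¬ cyclotomic r ℤ ^ 4 ∣ (X ^ (p + q) + C b * X ^ p + C (s * b) * X ^ q + C s : ℤ[X]) := by
  intro h4
  set Φ : ℤ[X] := cyclotomic r ℤ with hΦ
  set n := p + q with hn
  have hs0 : s ≠ 0 := by rcases hs with h | h <;> simp [h]
  -- the three operators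
  have hP : (X ^ n + C b * X ^ p + C (s * b) * X ^ q + C s : ℤ[X]) =
      C 1 * X ^ n + C b * X ^ p + C (s * b) * X ^ q + C s := by rw [map_one, one_mul]
  set F1 : ℤ[X] := C 0 * X ^ n + C (b * (p - n : ℤ)) * X ^ p + C (s * b * (q - n : ℤ)) * X ^ q + C (-(s * n))
    with hF1
  set F2 : ℤ[X] := C 0 * X ^ n + C (b * (p - n : ℤ) * (p - q : ℤ)) * X ^ p + C 0 * X ^ q + C (s * n * q)
    with hF2
  have h1 : X * derivative (X ^ n + C b * X ^ p + C (s * b) * X ^ q + C s : ℤ[X]) -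
      C (n : ℤ) * (X ^ n + C b * X ^ p + C (s * b) * X ^ q + C s) = F1 := by
    rw [hP, X_mul_derivative_four (by omega) hp (by omega), hF1]
    simp only [map_mul, map_sub, map_neg, map_zero, map_one, map_natCast]
    ring
  have h2 : X * derivative F1 - C (q : ℤ) * F1 = F2 := by
    rw [hF1, X_mul_derivative_four (by omega) hp (by omega), hF2]
    simp only [map_mul, map_sub, map_neg, map_zero, map_natCast]
    ring
  have h3 : X * derivative F2 - C (p : ℤ) * F2 = C (-(s * n * p * q)) := by
    rw [hF2, X_mul_derivative_four (by omega) hp (by omega)]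
    simp only [map_mul, map_sub, map_neg, map_zero, map_natCast]
    ring
  have d3 : Φ ^ 3 ∣ F1 := by rw [← h1]; exact pow_dvd_X_mul_derivative_sub h4 _
  have d2 : Φ ^ 2 ∣ F2 := by rw [← h2]; exact pow_dvd_X_mul_derivative_sub d3 _
  have d1 : Φ ^ 1 ∣ C (-(s * n * p * q)) := by rw [← h3]; exact pow_dvd_X_mul_derivative_sub d2 _
  rw [pow_one] at d1
  have hc : (-(s * (n : ℤ) * (p : ℤ) * (q : ℤ)) : ℤ) ≠ 0 := by
    have hn0 : n ≠ 0 := by omega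
    have hp0 : p ≠ 0 := hp.ne'
    have hq0 : q ≠ 0 := by omega
    simp only [ne_eq, neg_eq_zero, mul_eq_zero, Nat.cast_eq_zero, hs0, hn0, hp0, hq0, or_self,
      not_false_eq_true]
  have hd := natDegree_le_of_dvd d1 (C_ne_zero.mpr hc)
  rw [natDegree_C, hΦ, natDegree_cyclotomic] at hd
  have := Nat.totient_pos.mpr hr
  omega

/-- A divisor of a nonzero integer polynomial of Mahler measure `1` has Mahler measure `1`. -/
theorem intMahlerMeasure_eq_one_of_dvd {D F : ℤ[X]} (hDF : D ∣ F) (hF : F ≠ 0) (hM : intMahlerMeasure F = 1) :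
    intMahlerMeasure D = 1 := by
  obtain ⟨E, hE⟩ := hDF
  have hD : D ≠ 0 := by rintro rfl; rw [zero_mul] at hE; exact hF hE
  have hE0 : E ≠ 0 := by rintro rfl; rw [mul_zero] at hE; exact hF hE
  have hm := intMahlerMeasure_mul D E
  rw [← hE, hM] at hm
  have h1 := one_le_intMahlerMeasure hD
  have h2 := one_le_intMahlerMeasure hE0
  nlinarith

/-- **One peeling round** (`|b| ≥ 3`): every divisor `Q₀` of the quadrinomial factors as `Q₀ = D · Q'`
with `D ∣ x^{q-p} + s` and every cyclotomic factor of `Q'` dividing `D`. -/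
theorem exists_round_quadrinomial (hp : 0 < p) (hpq : p < q) (hs : s = 1 ∨ s = -1) (hb : 3 ≤ |b|)
    {Q₀ : ℤ[X]} (hQ₀ : Q₀ ∣ (X ^ (p + q) + C b * X ^ p + C (s * b) * X ^ q + C s : ℤ[X])) :
    ∃ D Q' : ℤ[X], Q₀ = D * Q' ∧ D ∣ (X ^ (q - p) + C s : ℤ[X]) ∧
      ∀ m : ℕ, 0 < m → cyclotomic m ℤ ∣ Q' → cyclotomic m ℤ ∣ D := by
  have hP0 : (X ^ (p + q) + C b * X ^ p + C (s * b) * X ^ q + C s : ℤ[X]) ≠ 0 :=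
    (quadrinomial_monic_natDegree hp hpq b s).1.ne_zero
  have hQ00 : Q₀ ≠ 0 := by rintro rfl; exact hP0 (zero_dvd_iff.mp hQ₀)
  have key : ∀ d : ℕ, ∀ D Q' : ℤ[X], Q'.natDegree = d → Q₀ = D * Q' → D ∣ (X ^ (q - p) + C s : ℤ[X]) →
      ∃ D' Q'' : ℤ[X], Q₀ = D' * Q'' ∧ D' ∣ (X ^ (q - p) + C s : ℤ[X]) ∧
        ∀ m : ℕ, 0 < m → cyclotomic m ℤ ∣ Q'' → cyclotomic m ℤ ∣ D' := by
    intro d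
    induction d using Nat.strong_induction_on with
    | _ d ih =>
      intro D Q' hd hDQ hDW
      by_cases hall : ∀ m : ℕ, 0 < m → cyclotomic m ℤ ∣ Q' → cyclotomic m ℤ ∣ D
      · exact ⟨D, Q', hDQ, hDW, hall⟩
      push Not at hall
      obtain ⟨m, hm, hmQ, hmD⟩ := hall
      obtain ⟨R, hR⟩ := hmQ
      have hQ'0 : Q' ≠ 0 := by rintro rfl; rw [mul_zero] at hDQ; exact hQ00 hDQ
      have hR0 : R ≠ 0 := by rintro rfl; rw [mul_zero] at hR; exact hQ'0 hR
      have hΦ0 : cyclotomic m ℤ ≠ 0 := cyclotomic_ne_zero m ℤ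
      have hmQ₀ : cyclotomic m ℤ ∣ Q₀ := ⟨D * R, by rw [hDQ, hR]; ring⟩
      have hmP := dvd_trans hmQ₀ hQ₀
      have hmW := cyclotomic_dvd_X_pow_add_of_dvd_quadrinomial hp hpq hs hb hm hmP
      have hprime : Prime (cyclotomic m ℤ) := (cyclotomic.irreducible hm).prime
      have hDW' : D * cyclotomic m ℤ ∣ (X ^ (q - p) + C s : ℤ[X]) := by
        obtain ⟨W', hW'⟩ := hDW
        have : cyclotomic m ℤ ∣ W' := by
          rcases hprime.dvd_or_dvd (hW' ▸ hmW) with h | h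
          · exact absurd h hmD
          · exact h
        rw [hW']; exact mul_dvd_mul_left D this
      have hdR : R.natDegree < d := by
        rw [← hd, hR, natDegree_mul hΦ0 hR0, natDegree_cyclotomic]
        have := Nat.totient_pos.mpr hm
        omega
      exact ih R.natDegree hdR (D * cyclotomic m ℤ) R rfl (by rw [hDQ, hR]; ring) hDW'
  exact key Q₀.natDegree 1 Q₀ rfl (one_mul Q₀).symm (one_dvd _)

/-- **Three rounds suffice** (`|b| ≥ 3`): `P = D · Q` with `Q` cyclotomic-free and `D ∣ (x^{q-p} + s)³`
(a cyclotomic factor surviving three rounds would divide `P` four times). -/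
theorem exists_cyclotomicFree_factor_quadrinomial_three (hp : 0 < p) (hpq : p < q) (hs : s = 1 ∨ s = -1)
    (hb : 3 ≤ |b|) :
    ∃ D Q : ℤ[X], (X ^ (p + q) + C b * X ^ p + C (s * b) * X ^ q + C s : ℤ[X]) = D * Q ∧
      D ∣ (X ^ (q - p) + C s : ℤ[X]) ^ 3 ∧ (∀ m : ℕ, 0 < m → ¬ cyclotomic m ℤ ∣ Q) := by
  obtain ⟨D₁, Q₁, h1, hD1, hr1⟩ := exists_round_quadrinomial hp hpq hs hb (dvd_refl _)
  obtain ⟨D₂, Q₂, h2, hD2, hr2⟩ := exists_round_quadrinomial hp hpq hs hb (Q₀ := Q₁) ⟨D₁, by rw [h1]; ring⟩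
  obtain ⟨D₃, Q₃, h3, hD3, hr3⟩ := exists_round_quadrinomial hp hpq hs hb (Q₀ := Q₂)
    ⟨D₁ * D₂, by rw [h1, h2]; ring⟩
  refine ⟨D₁ * D₂ * D₃, Q₃, by rw [h1, h2, h3]; ring, ?_, ?_⟩
  · rw [pow_succ, pow_two]
    exact mul_dvd_mul (mul_dvd_mul hD1 hD2) hD3
  · intro m hm hmQ3
    have hΦ3 : cyclotomic m ℤ ∣ D₃ := hr3 m hm hmQ3
    have hQ2 : cyclotomic m ℤ * cyclotomic m ℤ ∣ Q₂ := by rw [h3]; exact mul_dvd_mul hΦ3 hmQ3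
    have hΦ2 : cyclotomic m ℤ ∣ D₂ := hr2 m hm (dvd_trans (dvd_mul_right _ _) hQ2)
    have hQ1 : cyclotomic m ℤ * (cyclotomic m ℤ * cyclotomic m ℤ) ∣ Q₁ := by
      rw [h2]; exact mul_dvd_mul hΦ2 hQ2
    have hΦ1 : cyclotomic m ℤ ∣ D₁ := hr1 m hm (dvd_trans (dvd_mul_right _ _) hQ1)
    have h4 : cyclotomic m ℤ ^ 4 ∣ (X ^ (p + q) + C b * X ^ p + C (s * b) * X ^ q + C s : ℤ[X]) := by
      rw [h1, show cyclotomic m ℤ ^ 4 = cyclotomic m ℤ * (cyclotomic m ℤ * (cyclotomic m ℤ * cyclotomic m ℤ))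
        by ring]
      exact mul_dvd_mul hΦ1 hQ1
    exact not_cyclotomic_pow_four_dvd_quadrinomial hp hpq hs b hm h4

/-- **The family `p + q = |b| (q - p)`, `|b| ≥ 3`: not sub-Lehmer.**  For `|b| = 3` the quadrinomial is
`R(x^k)` with `deg R = 3` (kernel ladder); for `|b| ≥ 4`, `P = D Q` with `deg D ≤ 3k`, `M(D) = 1`, and
the resultant step on `Q` gives `|b|^{deg Q} ≤ 2^{deg Q} M^{n}` with `deg Q ≥ (|b| - 3) k`, so `M⁴ ≥ 2`. -/
theorem not_subLehmer_quadrinomial_special (hp : 0 < p) (hpq : p < q) (hs : s = 1 ∨ s = -1)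
    (hb : 3 ≤ |b|) (hfam : p + q = b.natAbs * (q - p)) :
    ¬ SubLehmer (X ^ (p + q) + C b * X ^ p + C (s * b) * X ^ q + C s : ℤ[X]) := by
  obtain ⟨hmon, hdeg⟩ := quadrinomial_monic_natDegree hp hpq b s
  set B := b.natAbs with hB
  have hB3 : 3 ≤ B := by
    have : (3 : ℤ) ≤ (b.natAbs : ℤ) := by rw [Int.natCast_natAbs]; exact hb
    exact_mod_cast this
  set k := q - p with hk
  have hkpos : 0 < k := by omega
  by_cases hB3' : B = 3
  · -- `P = R(x^k)`, `R` the cubic quadrinomial with `p' = 1`, `q' = 2`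
    have hp1 : p = k := by rw [hB3'] at hfam; omega
    have hq2 : q = 2 * k := by omega
    have hPR : (X ^ (p + q) + C b * X ^ p + C (s * b) * X ^ q + C s : ℤ[X]) =
        (X ^ (1 + 2) + C b * X ^ 1 + C (s * b) * X ^ 2 + C s : ℤ[X]).comp (X ^ k) := by
      simp only [add_comp, mul_comp, pow_comp, X_comp, C_comp]
      rw [hp1, hq2]; ring
    intro hsub
    have hsubR : SubLehmer (X ^ (1 + 2) + C b * X ^ 1 + C (s * b) * X ^ 2 + C s : ℤ[X]) := by
      unfold SubLehmer at hsub ⊢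
      rwa [hPR, intMahlerMeasure_comp_X_pow _ hkpos] at hsub
    have h24 := twentyfour_le_natDegree_of_subLehmer hsubR
    rw [(quadrinomial_monic_natDegree (p := 1) (q := 2) (by norm_num) (by norm_num) b s).2] at h24
    omega
  · have hB4 : 4 ≤ B := by omega
    obtain ⟨D, Q, hPQ, hDW, hcfQ⟩ := exists_cyclotomicFree_factor_quadrinomial_three hp hpq hs hb
    set P : ℤ[X] := X ^ (p + q) + C b * X ^ p + C (s * b) * X ^ q + C s with hP
    set n := p + q with hn
    have hP0 : P ≠ 0 := hmon.ne_zero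
    have hD0 : D ≠ 0 := by rintro rfl; rw [zero_mul] at hPQ; exact hP0 hPQ
    have hQ0 : Q ≠ 0 := by rintro rfl; rw [mul_zero] at hPQ; exact hP0 hPQ
    have hss : s * s = 1 := by rcases hs with h | h <;> simp [h]
    have hCs : (C s : ℤ[X]) * C s = 1 := by rw [← map_mul, hss, map_one]
    -- `deg D ≤ 3k`, `M(D) = 1`
    have hW0 : ((X ^ k + C s : ℤ[X]) ^ 3) ≠ 0 := pow_ne_zero 3 (monic_X_pow_add_C s (by omega)).ne_zero
    have hdD : D.natDegree ≤ 3 * k := by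
      have := natDegree_le_of_dvd hDW hW0
      rw [natDegree_pow, natDegree_X_pow_add_C] at this
      omega
    have hdegs : D.natDegree + Q.natDegree = n := by rw [← hdeg, hPQ, natDegree_mul hD0 hQ0]
    have hMD : intMahlerMeasure D = 1 := by
      have hW1 : intMahlerMeasure (X ^ k + C s : ℤ[X]) = 1 := by
        refine intMahlerMeasure_eq_one_of_mul_eq_X_pow_sub_one (s := X ^ k - C s) (by omega : 0 < 2 * k) ?_
        rw [pow_mul, sq]
        linear_combination (-1 : ℤ[X]) * hCs
      refine intMahlerMeasure_eq_one_of_dvd hDW hW0 ?_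
      rw [show ((X ^ k + C s : ℤ[X]) ^ 3) = (X ^ k + C s) * ((X ^ k + C s) * (X ^ k + C s)) by ring,
        intMahlerMeasure_mul, intMahlerMeasure_mul, hW1]
      norm_num
    have hMQ : intMahlerMeasure Q = intMahlerMeasure P := by
      rw [hPQ, intMahlerMeasure_mul, hMD, one_mul]
    -- resultant step on `Q` with `G = xⁿ + s = C b * (-(X^p + C s * X^q)) + Q * D`
    have hG : (X ^ n + C s : ℤ[X]) = C b * (-(X ^ p + C s * X ^ q)) + Q * D := by
      rw [mul_comm Q D, ← hPQ, hP, map_mul]; ring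
    have hGdeg : (X ^ n + C s : ℤ[X]).natDegree ≤ n := by rw [natDegree_X_pow_add_C]
    have hne : Q.resultant (X ^ n + C s) Q.natDegree n ≠ 0 := by
      refine resultant_ne_zero_of_cyclotomicFree (L := 2 * n) hQ0 hcfQ hGdeg (by omega) ?_
      intro z hz
      simp only [Polynomial.map_add, Polynomial.map_pow, map_X, eq_intCast, Polynomial.map_intCast,
        eval_add, eval_pow, eval_X, eval_intCast] at hz
      have hz' : z ^ n = -(s : ℂ) := eq_neg_of_add_eq_zero_left hz
      rw [pow_mul', hz', neg_sq]
      rcases hs with h | h <;> simp [h]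
    have hroot : ∀ α : ℂ, ‖((X ^ n + C s : ℤ[X]).map (Int.castRingHom ℂ)).eval α‖ ≤ 2 * max 1 ‖α‖ ^ n := by
      intro α
      simp only [Polynomial.map_add, Polynomial.map_pow, map_X, eq_intCast, Polynomial.map_intCast,
        eval_add, eval_pow, eval_X, eval_intCast]
      exact norm_pow_add_le_two_mul α (s : ℂ) (norm_intCast_le_one_of_sign hs) n
    have h := abs_pow_le_pow_mul_measure_pow_of_resultant (K := 2) hG (by omega) hGdeg hne hroot
    rw [hMQ] at h
    set M := intMahlerMeasure P with hM
    have hM1 : 1 ≤ M := one_le_intMahlerMeasure hP0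
    -- `4^{deg Q} ≤ |b|^{deg Q} ≤ 2^{deg Q} Mⁿ`, so `2^{deg Q} ≤ Mⁿ`
    have hb4 : (4 : ℝ) ≤ |(b : ℝ)| := by
      have : (4 : ℤ) ≤ |b| := by
        have h' : (b.natAbs : ℤ) = |b| := Int.natCast_natAbs b
        omega
      exact_mod_cast this
    have h2 : (2 : ℝ) ^ Q.natDegree ≤ M ^ n := by
      have h4 : (4 : ℝ) ^ Q.natDegree ≤ 2 ^ Q.natDegree * M ^ n :=
        le_trans (pow_le_pow_left₀ (by norm_num) hb4 _) h
      rw [show (4 : ℝ) ^ Q.natDegree = 2 ^ Q.natDegree * 2 ^ Q.natDegree by rw [← mul_pow]; norm_num] at h4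
      exact le_of_mul_le_mul_left h4 (by positivity)
    -- `deg Q ≥ (B - 3) k` and `n = B k`, so `2ⁿ ≤ 2^{4 deg Q} ≤ M^{4n}`
    have hnB : n = B * k := hfam
    have hQd : n ≤ 4 * Q.natDegree := by
      have : Q.natDegree + 3 * k ≥ n := by omega
      rw [hnB] at this ⊢
      nlinarith
    have h3 : (2 : ℝ) ^ n ≤ (M ^ 4) ^ n := by
      calc (2 : ℝ) ^ n ≤ 2 ^ (4 * Q.natDegree) := pow_le_pow_right₀ (by norm_num) hQd
        _ = (2 ^ Q.natDegree) ^ 4 := by rw [mul_comm, pow_mul]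
        _ ≤ (M ^ n) ^ 4 := pow_le_pow_left₀ (by positivity) h2 4
        _ = (M ^ 4) ^ n := by rw [← pow_mul, ← pow_mul, mul_comm]
    have hM4 : (2 : ℝ) ≤ M ^ 4 := le_of_pow_le_pow_left₀ (by omega : n ≠ 0) (by positivity) h3
    intro hsub
    have hL := lehmer_measure_upper_bound
    obtain ⟨_, hlt⟩ := hsub
    have hMlt : M < 117629 / 100000 := lt_trans hlt hL
    have hM0 : 0 ≤ M := by linarith
    have : M ^ 4 < (117629 / 100000 : ℝ) ^ 4 := pow_lt_pow_left₀ hMlt hM0 (by norm_num)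
    norm_num at this
    linarith

/-- **No quadrinomial `x^{p+q} + b x^p + s b x^q + s` with `|b| ≥ 3` is sub-Lehmer** (`0 < p < q`,
`s = ±1`), with or without cyclotomic factors, in or outside the family `p + q = |b| (q - p)`. -/
theorem not_subLehmer_quadrinomial_of_three_le_abs' (hp : 0 < p) (hpq : p < q) (hs : s = 1 ∨ s = -1)
    (hb : 3 ≤ |b|) :
    ¬ SubLehmer (X ^ (p + q) + C b * X ^ p + C (s * b) * X ^ q + C s : ℤ[X]) := by
  by_cases hfam : p + q = b.natAbs * (q - p)
  · exact not_subLehmer_quadrinomial_special hp hpq hs hb hfam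
  · exact not_subLehmer_quadrinomial_of_three_le_abs hp hpq hs hb hfam

end Quadrinomial

end Summit.Ventures.DiscreteObjects.Mahler
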